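import Literature.AlgebraicGeometry.Resolution.ExcCurveSelfIntersectionH0
import Literature.AlgebraicGeometry.Resolution.Lipman1969IntersectionTheory
import HarnessLib

/-!
# Lipman 1969, Proposition (13.1) b), d) in the rational regime are theorems modulo Prop. (1.2):
# `Lipman1969_1_2 → Lipman1969_13_1_d_rat`, `Lipman1969_1_2 → Lipman1969_13_1_b_rat`

Topic: `Literature/AlgebraicGeometry/Resolution`.  PROVED, fact-free, definition-free.  J. Lipman, *Rational
singularities, with applications to algebraic surfaces and unique factorization*, Publ. Math. IHÉS 36 (1969),
§13 Prop. (13.1) b) "`(D·(E+F)) = (D·E) + (D·F)`", d) "`(F·E) = χ(E) + χ(F) − χ(E+F)`" (p. 223).  The tree's named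
facts `Lipman1969_13_1_d_rat`, `Lipman1969_13_1_b_rat` (`Resolution/Lipman1969IntersectionTheory`: the `h⁰`-form
over a two-dimensional normal local domain with a rational singularity, for products of prime ideals of integral
exceptional curves) are DERIVED here from Prop. (1.2) 2) (`Lipman1969_1_2`: `H¹ = 0` on every desingularisation),
and proved OUTRIGHT for a desingularisation with `H¹(X, 𝒪_X) = 0`:

the cross-step `Δ_E(𝓛𝓘_F) = Δ_E(𝓛) − (F·E)` (`Resolution/ExcCurveTwistAdditivity`) and the self-step
`Δ_E(𝓛𝓘_E) = Δ_E(𝓛) − (E·E)` (`Resolution/ExcCurveSelfIntersectionH0`), `Δ_E(𝓛) := h⁰(𝒪/𝓛𝓘_E) − h⁰(𝒪/𝓛)`, show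
that `Δ_E(𝓛𝓘_ζ) − Δ_E(𝓛)` does not depend on `𝓛` (`h0_delta_step_indep`); hence `Δ_E` is additive on products up
to the constant `Δ_E(1) = h⁰(E)` (`h0_delta_add`, Riemann–Roch for exceptional line bundles on `E` in `h⁰`-form),
and Lipman's symbol `⟨𝓐,𝓑⟩ = h⁰(𝒪/𝓐) + h⁰(𝒪/𝓑) − h⁰(𝒪/𝓐𝓑)` is bi-additive (`h0_biadditivity`).

* `h0_one` — `h⁰(𝒪_X/(1)) = 0`;
* `h0_delta_step_indep`, `h0_delta_add`;
* **`h0_biadditivity`** — (13.1) b)+d) in `h⁰`-form for ALL multisets (given `H¹(X, 𝒪_X) = 0`);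
* **`excCurveDegree_primeDivisor_eq_h0`** — (13.1) d) in `h⁰`-form incl. `η = η′` (given `H¹(X, 𝒪_X) = 0`);
* **`Lipman1969_13_1_d_rat_of_1_2`**, **`Lipman1969_13_1_b_rat_of_1_2`** — the named facts modulo `Lipman1969_1_2`.

## References
* J. Lipman, Publ. Math. IHÉS 36 (1969), §13 Prop. (13.1) b), d) (p. 223); Prop. (1.2) (p. 199). [Lipman1969]
-/

noncomputable section

open CategoryTheory CategoryTheory.Limits AlgebraicGeometry TopologicalSpace IsLocalRing Opposite
open Literature.AlgebraicGeometry.Morphisms Literature.AlgebraicGeometry.Modules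
open Literature.AlgebraicGeometry.Motives
open Scheme.IdealSheafData

universe u

namespace Literature.AlgebraicGeometry.Resolution

/-! ## §1 `h⁰(𝒪/(1)) = 0` -/

/-- `h⁰(𝒪_X/(1)) = 0`: the subscheme of the unit ideal sheaf is empty. [cite: Lipman1969, Section 10 (p. 212)] -/
theorem h0_one {S : Type u} [CommRing S] {X : Scheme.{u}} (π : X ⟶ Spec (.of S)) :
    h0 π (1 : X.IdealSheafData) = 0 := by
  rw [one_eq_top, h0_eq]
  set Y := (⊤ : X.IdealSheafData).subscheme with hY
  haveI : IsEmpty Y := inferInstanceAs (IsEmpty (⊤ : X.IdealSheafData).subscheme)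
  have htop : (⊤ : Y.Opens) = ⊥ := SetLike.ext' (Set.eq_empty_of_isEmpty _)
  haveI : Subsingleton Γ(Y, (⊤ : Y.Opens)) :=
    CommRingCat.subsingleton_of_isTerminal (Y.sheaf.isTerminalOfEqEmpty htop)
  haveI : Subsingleton (Sections ((⊤ : X.IdealSheafData).subschemeι ≫ π) ⊤) :=
    inferInstanceAs (Subsingleton Γ(Y, (⊤ : Y.Opens)))
  exact Module.length_eq_zero

/-! ## §2 `Δ_E(𝓛𝓘_ζ) − Δ_E(𝓛)` is independent of `𝓛`; additivity of `Δ_E` -/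

section Main

variable {A : Type u} [CommRing A] [IsNoetherianRing A] [IsLocalRing A] [IsDomain A]
  {X : Scheme.{u}} [IsIntegral X] [IsLocallyNoetherian X] (π : X ⟶ Spec (.of A))

omit [IsIntegral X] [IsLocallyNoetherian X] in
/-- Products of exceptional primes over a `cons`. [folklore] -/
private theorem prod_map_cons' (a : X) (t : Multiset X) :
    ((a ::ₘ t).map primeDivisorIdeal).prod = (t.map primeDivisorIdeal).prod * primeDivisorIdeal a := by
  rw [Multiset.map_cons, Multiset.prod_cons, mul_comm]

/-- **`Δ_E(𝓛𝓘_ζ) − Δ_E(𝓛) = Δ_E(𝓘_ζ) − Δ_E(1)`** (`Δ_E(𝓛) = h0(𝓛𝓘_E) − h0(𝓛)`): the change of `Δ_E` under an extra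
factor `𝓘_ζ` does not depend on the exceptional product `𝓛` (it is `−(E_ζ·E)`: the cross-step for `ζ ≠ η`, the
self-step for `ζ = η`). [cite: Lipman1969, Proposition (13.1) b) and d) (p. 223)] -/
theorem h0_delta_step_indep (hA : ringKrullDim A = 2) (hπ : IsResolution π) (h1 : HasTrivialCechH1 π)
    (t : Multiset X) (ht : ∀ ζ ∈ t, ζ ∈ excCurvePoints π) {ζ η : X} (hζ : ζ ∈ excCurvePoints π)
    (hη : η ∈ excCurvePoints π) :
    ((h0 π ((t.map primeDivisorIdeal).prod * primeDivisorIdeal ζ * primeDivisorIdeal η)).toNat : ℤ) -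
        (h0 π ((t.map primeDivisorIdeal).prod * primeDivisorIdeal ζ)).toNat -
        (((h0 π ((t.map primeDivisorIdeal).prod * primeDivisorIdeal η)).toNat : ℤ) -
          (h0 π (t.map primeDivisorIdeal).prod).toNat) =
      ((h0 π ((1 : X.IdealSheafData) * primeDivisorIdeal ζ * primeDivisorIdeal η)).toNat : ℤ) -
        (h0 π ((1 : X.IdealSheafData) * primeDivisorIdeal ζ)).toNat -
        (((h0 π ((1 : X.IdealSheafData) * primeDivisorIdeal η)).toNat : ℤ) -
          (h0 π (1 : X.IdealSheafData)).toNat) := by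
  have hX : Scheme.IsRegular X := hπ.isRegular
  have hF : IsEffectiveCartier (primeDivisorIdeal ζ) :=
    isEffectiveCartier_primeDivisorIdeal_of_isRegular hX (hπ.coheight_eq_one_of_mem_excCurvePoints hA hζ)
  have h0nil : ∀ ζ' ∈ (0 : Multiset X), ζ' ∈ excCurvePoints π := fun _ h => absurd h (Multiset.notMem_zero _)
  by_cases hne : η = ζ
  · subst hne
    have jt := hπ.h0_prod_self_step π hA h1 t ht hη hF
    have j0 := hπ.h0_prod_self_step π hA h1 0 h0nil hη hF
    simp only [Multiset.map_zero, Multiset.prod_zero] at j0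
    simp only at jt
    linarith
  · have jt := hπ.h0_prod_cross_step π hA h1 t ht hη hζ hne hF
    have j0 := hπ.h0_prod_cross_step π hA h1 0 h0nil hη hζ hne hF
    simp only [Multiset.map_zero, Multiset.prod_zero] at j0
    simp only at jt
    linarith

/-- **Additivity of `Δ_E` on products**: `Δ_E(𝓛_{s+t}) + Δ_E(1) = Δ_E(𝓛_s) + Δ_E(𝓛_t)` for products
`𝓛_m = ∏_{ζ∈m} 𝓘_ζ` of prime ideals of integral exceptional curves (`Δ_E(𝓛) = h0(𝓛𝓘_E) − h0(𝓛)`; with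
`Δ_E(1) = h⁰(E)` this is Riemann–Roch `χ(𝒪_E(−L)) = h⁰(E) − (L·E)` in `h⁰`-form).
[cite: Lipman1969, Proposition (13.1) b) and d) (p. 223)] -/
theorem h0_delta_add (hA : ringKrullDim A = 2) (hπ : IsResolution π) (h1 : HasTrivialCechH1 π)
    (s t : Multiset X) (hs : ∀ ζ ∈ s, ζ ∈ excCurvePoints π) (ht : ∀ ζ ∈ t, ζ ∈ excCurvePoints π)
    {η : X} (hη : η ∈ excCurvePoints π) :
    ((h0 π (((s + t).map primeDivisorIdeal).prod * primeDivisorIdeal η)).toNat : ℤ) -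
        (h0 π ((s + t).map primeDivisorIdeal).prod).toNat +
        (((h0 π ((1 : X.IdealSheafData) * primeDivisorIdeal η)).toNat : ℤ) - (h0 π (1 : X.IdealSheafData)).toNat) =
      ((h0 π ((s.map primeDivisorIdeal).prod * primeDivisorIdeal η)).toNat : ℤ) -
          (h0 π (s.map primeDivisorIdeal).prod).toNat +
        (((h0 π ((t.map primeDivisorIdeal).prod * primeDivisorIdeal η)).toNat : ℤ) -
          (h0 π (t.map primeDivisorIdeal).prod).toNat) := by
  induction t using Multiset.induction_on with
  | empty =>
    simp only [Multiset.add_zero, Multiset.map_zero, Multiset.prod_zero]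
  | cons a t ih =>
    have ha : a ∈ excCurvePoints π := ht a (Multiset.mem_cons_self a t)
    have ht' : ∀ ζ ∈ t, ζ ∈ excCurvePoints π := fun ζ hζ => ht ζ (Multiset.mem_cons_of_mem hζ)
    have hst : ∀ ζ ∈ s + t, ζ ∈ excCurvePoints π := fun ζ hζ =>
      (Multiset.mem_add.mp hζ).elim (hs ζ) (ht' ζ)
    have ih' := ih ht'
    have step₁ := h0_delta_step_indep π hA hπ h1 (s + t) hst ha hη
    have step₂ := h0_delta_step_indep π hA hπ h1 t ht' ha hη
    rw [Multiset.add_cons, prod_map_cons', prod_map_cons']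
    linarith

/-- **Lipman 1969, Prop. (13.1) b)+d) in `h⁰`-lengths, for ALL exceptional curves (common components allowed)**:
on a resolution `π : X → Spec A` of a two-dimensional Noetherian local domain with `H¹(X, 𝒪_X) = 0`, for products
`𝓘 = 𝓛_s`, `𝓙 = 𝓛_t`, `𝓚 = 𝓛_u` of prime ideals of integral exceptional curves,
`h0 𝓘 + h0(𝓙𝓚) − h0(𝓘𝓙𝓚) = (h0 𝓘 + h0 𝓙 − h0(𝓘𝓙)) + (h0 𝓘 + h0 𝓚 − h0(𝓘𝓚))`, i.e. `(E·(F+G)) = (E·F) + (E·G)`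
with `(A·B) = χ(A) + χ(B) − χ(A+B)`, `χ = h⁰`. [cite: Lipman1969, Proposition (13.1) b) and d) (p. 223)] -/
theorem h0_biadditivity (hA : ringKrullDim A = 2) (hπ : IsResolution π) (h1 : HasTrivialCechH1 π)
    (s t u : Multiset X) (hs : ∀ η ∈ s, η ∈ excCurvePoints π) (ht : ∀ η ∈ t, η ∈ excCurvePoints π)
    (hu : ∀ η ∈ u, η ∈ excCurvePoints π) :
    ((h0 π (s.map primeDivisorIdeal).prod).toNat : ℤ) + (h0 π ((t + u).map primeDivisorIdeal).prod).toNat -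
        (h0 π ((s + (t + u)).map primeDivisorIdeal).prod).toNat =
      (((h0 π (s.map primeDivisorIdeal).prod).toNat : ℤ) + (h0 π (t.map primeDivisorIdeal).prod).toNat -
          (h0 π ((s + t).map primeDivisorIdeal).prod).toNat) +
        (((h0 π (s.map primeDivisorIdeal).prod).toNat : ℤ) + (h0 π (u.map primeDivisorIdeal).prod).toNat -
          (h0 π ((s + u).map primeDivisorIdeal).prod).toNat) := by
  have htu : ∀ η ∈ t + u, η ∈ excCurvePoints π := fun η hη => (Multiset.mem_add.mp hη).elim (ht η) (hu η)
  induction s using Multiset.induction_on with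
  | empty =>
    simp only [Multiset.zero_add, Multiset.map_zero, Multiset.prod_zero, h0_one, ENat.toNat_zero, Nat.cast_zero]
    ring
  | cons a s ih =>
    have ha : a ∈ excCurvePoints π := hs a (Multiset.mem_cons_self a s)
    have hs' : ∀ ζ ∈ s, ζ ∈ excCurvePoints π := fun ζ hζ => hs ζ (Multiset.mem_cons_of_mem hζ)
    have ih' := ih hs'
    have g₁ := h0_delta_add π hA hπ h1 s (t + u) hs' htu ha
    have g₂ := h0_delta_add π hA hπ h1 s t hs' ht ha
    have g₃ := h0_delta_add π hA hπ h1 s u hs' hu ha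
    have g₄ := h0_delta_add π hA hπ h1 t u ht hu ha
    rw [Multiset.cons_add, Multiset.cons_add, Multiset.cons_add, prod_map_cons', prod_map_cons', prod_map_cons',
      prod_map_cons']
    linarith

/-- **Lipman 1969, Prop. (13.1) d) in `h⁰`-lengths, for ALL pairs of integral exceptional curves (`η = η′`
included)**: on a resolution with `H¹(X, 𝒪_X) = 0` of a two-dimensional Noetherian local domain,
`(F·E) = excCurveDegree π [E_{η′}] η = h0 𝓘_η + h0 𝓘_{η′} − h0 (𝓘_{η′} 𝓘_η)`; for `η = η′`, `(E·E) = 2h⁰(E) − h⁰(2E)`.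
[cite: Lipman1969, Proposition (13.1) d) (p. 223)] -/
theorem excCurveDegree_primeDivisor_eq_h0 (hA : ringKrullDim A = 2) (hπ : IsResolution π)
    (h1 : HasTrivialCechH1 π) {η η' : X} (hη : η ∈ excCurvePoints π) (hη' : η' ∈ excCurvePoints π)
    (hF : IsEffectiveCartier (primeDivisorIdeal η')) :
    excCurveDegree π (CartierDivisor.ofIsEffectiveCartier (primeDivisorIdeal η') hF) η =
      ((h0 π (primeDivisorIdeal η)).toNat : ℤ) + ((h0 π (primeDivisorIdeal η')).toNat : ℤ) -
        ((h0 π (primeDivisorIdeal η' * primeDivisorIdeal η)).toNat : ℤ) := by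
  by_cases hne : η = η'
  · subst hne
    have h0nil : ∀ ζ' ∈ (0 : Multiset X), ζ' ∈ excCurvePoints π := fun _ h => absurd h (Multiset.notMem_zero _)
    have j0 := hπ.h0_prod_self_step π hA h1 0 h0nil hη hF
    simp only [Multiset.map_zero, Multiset.prod_zero, one_mul, h0_one, ENat.toNat_zero, Nat.cast_zero] at j0
    linarith
  · exact excCurveDegree_primeDivisor_eq_h0_of_ne hA hπ h1 hη hη' hne hF

end Main

/-! ## §3 The named facts modulo Prop. (1.2) -/

/-- **`Lipman1969_13_1_d_rat` is a theorem modulo Prop. (1.2)** (`H¹(X, 𝒪_X) = 0` for the given desingularisation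
follows from the rational singularity by `Lipman1969_1_2` 2)). [cite: Lipman1969, Proposition (13.1) d) (p. 223)] -/
theorem Lipman1969_13_1_d_rat_of_1_2 (h12 : Lipman1969_1_2.{u}) : Lipman1969_13_1_d_rat.{u} := by
  intro S _ _ _ _ _ hdim hrat X _ _ π hπ η hη η' hη' hF
  exact excCurveDegree_primeDivisor_eq_h0 π hdim hπ (h12.hasTrivialCechH1_of_isResolution hdim hrat π hπ) hη hη' hF

/-- **`Lipman1969_13_1_b_rat` is a theorem modulo Prop. (1.2)**. [cite: Lipman1969, Proposition (13.1) b) and d) (p. 223)] -/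
theorem Lipman1969_13_1_b_rat_of_1_2 (h12 : Lipman1969_1_2.{u}) : Lipman1969_13_1_b_rat.{u} := by
  intro S _ _ _ _ _ hdim hrat X π hπ s t u _ _ _ hs ht hu
  haveI : IsIntegral X := hπ.isIntegral_source
  haveI : IsProper π := hπ.isProper
  haveI : IsLocallyNoetherian X := LocallyOfFiniteType.isLocallyNoetherian π
  have h1 := h12.hasTrivialCechH1_of_isResolution hdim hrat π hπ
  have hprod : ∀ a b : Multiset X, ((a.map primeDivisorIdeal).prod * (b.map primeDivisorIdeal).prod : X.IdealSheafData) =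
      ((a + b).map primeDivisorIdeal).prod := fun a b => by rw [Multiset.map_add, Multiset.prod_add]
  have key := h0_biadditivity π hdim hπ h1 s t u hs ht hu
  show ((h0 π (s.map primeDivisorIdeal).prod).toNat : ℤ) +
      ((h0 π ((t.map primeDivisorIdeal).prod * (u.map primeDivisorIdeal).prod)).toNat : ℤ) -
      ((h0 π ((s.map primeDivisorIdeal).prod * (t.map primeDivisorIdeal).prod * (u.map primeDivisorIdeal).prod)).toNat : ℤ) =
    (((h0 π (s.map primeDivisorIdeal).prod).toNat : ℤ) + ((h0 π (t.map primeDivisorIdeal).prod).toNat : ℤ) -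
        ((h0 π ((s.map primeDivisorIdeal).prod * (t.map primeDivisorIdeal).prod)).toNat : ℤ)) +
      (((h0 π (s.map primeDivisorIdeal).prod).toNat : ℤ) + ((h0 π (u.map primeDivisorIdeal).prod).toNat : ℤ) -
        ((h0 π ((s.map primeDivisorIdeal).prod * (u.map primeDivisorIdeal).prod)).toNat : ℤ))
  rw [mul_assoc, hprod t u, hprod s (t + u), hprod s t, hprod s u]
  exact key

end Literature.AlgebraicGeometry.Resolution

end
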